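import Mathlib
import Literature.MathematicalPhysics.QuantumFieldTheory.Balaban1983to89.B6TowerDecomp
import Literature.MathematicalPhysics.QuantumFieldTheory.Balaban1983to89.B6Lemma21Counterexample

/-!
# `Balaban1983to89.B6Lemma21TwoDim` — T. Bałaban, *Propagators and renormalization transformations for lattice gauge
theories. II*, Commun. Math. Phys. **96** (1984) 223–250 [Balaban1984PropagatorsII]: Lemma 2.1 (2.61) in d = 2 — the
PRINTED constant c₁(α) = 12c₀(½α)² is EXCEEDED on the level tower `B6LevelTower.twGeo` (row decided: refuted as typed)

statement-level skeleton of published theorems with citation tags; proofs where landed; nothing here is a claim about the Yang–Mills mass gap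

PDF held: `paper:balaban1984-cmp96-propagators-rt-ii` (journal page = PDF page + 222).

CITATION HEADER (lit-balaban Phase-2 seat p04, unit `lit-balaban-p04`; HOME `run/shared/lean/pub/lit-balaban/`,
PHASE2-TARGETS.md §G.3 p04).  WHAT IS REPRODUCED: SKELETON row **B6.Lem2.1** («d = 2 printed constant: decide»): the
printed (2.61) *"sup_{y∈𝔅} Σ_{y′∈𝔅} e^{−αδ₀d(y,y′)} ≤ c₁(α)"* with *"c₁(α) = 12c₀^d(½α)"* (Lemma 2.1 p. 234 [PDF 12];
typed verbatim as `B6.Lemma21Printed` ∕ `B6RandomWalk.Ineq261` with `B6.c1`; condition (2.59) p. 233 = `B6.Cond259`),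
on the coordinatised towers `B6LevelTower.twGeo 2 k a M L η R` — the carrier on which the lineage PROVED the repaired
constant c₁″ = 13c₀(½α)^{4d} (`B6TowerDecomp.tower_sum_exp_le`: L ≥ 1, a ≥ 1, RM ≤ a + 1, α, δ₀ > 0, (2.59)).
VERDICT: **FALSE AS TYPED in d = 2** — under those same hypotheses the row sum at the near corner y₀ of the coarse box
Λ₁ exceeds 12c₀(½α)² whenever αδ₀ ≤ 1/400, αδ₀·L ≥ 4 and (4/(αδ₀))·L ≤ a + 1 (`c1_lt_sum_d2`, `not_ineq261_d2`;
explicit instance `printed_c1_exceeded_d2`: k = 1, L = 1600, a + 1 = 1600², αδ₀ = 1/400, where with M = 1, R = 1600²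
also (2.59) holds, `cond259_instance`; hence `not_tower_sum_le_printed_d2` and, for EVERY δ₀ > 0, an honest tower
refuting `B6.Lemma21Printed 2 δ₀` while the two-scale Lemma 2.1 holds on it, `not_lemma21Printed_d2`).  d ≥ 3 was
refuted by `B6Lemma21Counterexample.printed_c1_exceeded` (d = 4, L = 32, αδ₀ = ⅛) from HYPOTHESISED path bounds on a
slab geometry; here every path bound is PROVED on the concrete tower (`dist_base_finePt_le`).
MECHANISM (the cell's located cause G-A11-1 — the last leg of (2.47) ends at y′, not on a surface, so it pays no
factor e^{−½αδ₀RM} — quantified in d = 2; β := αδ₀).  From y₀ = (1,(0,0)) the coarse near-face sites (1,(0,x′)) are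
x′ bonds away; each with Lx′ ≤ a carries a wall bond (`B6LevelTower.bond`: the points of Λ₁ on the wall sit on LΛ₀) to
the fine far-face site (0,(a,Lx′)), from which (0,(a−t, Lx′+z)) is t + z fine bonds away.  So d(y₀,·) ≤ x′ + 1 + t + z
on (a+1)·n·L DISTINCT fine sites (x′ < n, t ≤ a, z < L; nL ≤ a + 1) and Σ_{y′} e^{−βd(y₀,y′)} ≥ e^{−β}G_nG_{a+1}G_L,
G_m = Σ_{s<m} e^{−βs} ≥ (1 − e^{−βm})/β ≥ (4/5)/β once βm ≥ 4 — order β^{−3} — against the printed 12c₀(½α)² =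
12((1 + e^{−β/2})/(1 − e^{−β/2}))² ≤ 12(4/β + 1)², order β^{−2}.  No `sorry`; axioms ⊆ {propext, Classical.choice,
Quot.sound}.
SCOPE ∕ CAVEATS.  (a) Refuted AS TYPED: δ₀ and L are independent parameters of `B6.Lemma21Printed` ∕ `twGeo`; the
witness needs αδ₀·L ≥ 4 with αδ₀ ≤ 1/400 (so L ≥ 1600).  Print's δ₀ = δ₀(d, L) of Proposition 2.2 is not explicit;
whether print's own pairs (L, δ₀(2, L)) admit such an α ∈ (0, 1) is NOT decided here.  (b) For αδ₀·L ≲ 2 the same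
mechanism yields ≈ (2 + 2L)/(αδ₀)² < 12c₀(½α)² (L ≤ 90), and exact breadth-first evaluation of tower sums
(HOME/lit-balaban-p04/, L ≤ 40) finds no violation: the printed constant on small-L towers in d = 2 stays UNDECIDED
(HOME/GAPS.md).  (c) The tower is the lineage's core sample of (2.1)–(2.4) (one box per level, one wall per interface,
wall bonds weigh 1 — print's crossing at a coarse point of Σ_j costs 0, which only enlarges print's sum).  (d) Consumers
use c₁ only as an α-dependent O(1) (`B6Lemma21Repaired`, `B6Lemma21TwoScale`, `DagBinding.B6Lemma21Param`); no
downstream statement changes.  NOT a statement about continuum Yang–Mills; NOT a mass-gap claim.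
-/

namespace Literature.MathematicalPhysics.QuantumFieldTheory.Balaban1983to89.B6Lemma21TwoDim

open Finset Real
open B6LevelTower
open B6CoverTwoLevel (zv clampBox zv_clampBox)
open Literature.Probability.LatticeModels (latL1Dist)

/-! ## §1  Elementary bounds: e^{−x}, c₀(½α), c₁ in d = 2, the geometric sum -/

/-- e^{−x} ≤ 1/(1 + x) for x ≥ 0. [folklore] -/
private theorem exp_neg_le_one_div {x : ℝ} (hx : 0 ≤ x) : Real.exp (-x) ≤ 1 / (1 + x) := by
  rw [Real.exp_neg, ← one_div]
  exact one_div_le_one_div_of_le (by linarith) (by linarith [Real.add_one_le_exp x])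

/-- **c₀(½α) ≤ 4/(αδ₀) + 1** (closed form `B6Lemma21Counterexample.c0_closed` and e^{−x} ≤ 1/(1+x)); print p. 233 uses
c₀(α) < 2(1 − e^{−αδ₀})^{−1} < 4/(αδ₀). [cite: Balaban1984PropagatorsII, p.233 (c₀(α) and its bound)] -/
theorem c0_half_le {δ₀ α : ℝ} (h : 0 < α * δ₀) : B6.c0 δ₀ (α / 2) ≤ (4 + α * δ₀) / (α * δ₀) := by
  have hpos : 0 < α / 2 * δ₀ := by linarith
  rw [B6Lemma21Counterexample.c0_closed hpos]
  set p := Real.exp (-(α / 2 * δ₀)) with hp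
  have hp1 : p < 1 := by rw [hp, Real.exp_lt_one_iff]; linarith
  have hp2 : p * (α * δ₀ + 2) ≤ 2 := by
    have h1 := mul_le_mul_of_nonneg_right (exp_neg_le_one_div hpos.le) (by linarith : (0 : ℝ) ≤ 1 + α / 2 * δ₀)
    rw [← hp, one_div, inv_mul_cancel₀ (by linarith : (1 + α / 2 * δ₀) ≠ 0)] at h1
    linarith
  rw [div_le_div_iff₀ (by linarith) h]
  nlinarith

/-- **The printed constant in d = 2 is at most 12(4/(αδ₀) + 1)²**: `B6.c1 2 δ₀ α` = 12c₀(½α)² ≤ 12((4 + αδ₀)/(αδ₀))².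
[cite: Balaban1984PropagatorsII, Lemma 2.1 p.234 (c₁(α) = 12c₀^d(½α))] -/
theorem c1_two_le {δ₀ α : ℝ} (h : 0 < α * δ₀) : B6.c1 2 δ₀ α ≤ 12 * ((4 + α * δ₀) / (α * δ₀)) ^ 2 := by
  have h0 : 0 ≤ B6.c0 δ₀ (α / 2) := by
    rw [B6Lemma21Counterexample.c0_closed (by linarith : 0 < α / 2 * δ₀)]
    have : Real.exp (-(α / 2 * δ₀)) < 1 := by rw [Real.exp_lt_one_iff]; linarith
    exact div_nonneg (by positivity) (by linarith)
  unfold B6.c1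
  linarith [pow_le_pow_left₀ h0 (c0_half_le h) 2]

/-- The one-dimensional sum G_m(β) = Σ_{s<m} e^{−βs} (the role of c₀ for a half-line). [folklore] -/
noncomputable def gsum (β : ℝ) (m : ℕ) : ℝ := ∑ s ∈ range m, Real.exp (-(β * s))

/-- G_m(β) ≥ 0. [folklore] -/
private theorem gsum_nonneg (β : ℝ) (m : ℕ) : 0 ≤ gsum β m := Finset.sum_nonneg fun _ _ => (Real.exp_pos _).le

/-- **G_m(β) ≥ (4/5)/β once βm ≥ 4** (β > 0): G_m·(1 − e^{−β}) = 1 − e^{−βm} ≥ 1 − e^{−4} ≥ 4/5 and 1 − e^{−β} ≤ β.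
[folklore] -/
private theorem gsum_ge {β : ℝ} (hβ : 0 < β) {m : ℕ} (hm : 4 ≤ β * m) : 4 / 5 / β ≤ gsum β m := by
  set q := Real.exp (-β) with hq
  have hq1 : 1 - q ≤ β := by linarith [Real.add_one_le_exp (-β)]
  have hkey : gsum β m * (1 - q) = 1 - q ^ m := by
    rw [← geom_sum_mul_neg q m, gsum]
    congr 1
    refine Finset.sum_congr rfl fun s _ => ?_
    rw [hq, ← Real.exp_nat_mul]
    ring_nf
  have hqm : q ^ m ≤ 1 / 5 := by
    rw [hq, ← Real.exp_nat_mul]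
    have h5 := exp_neg_le_one_div (by norm_num : (0 : ℝ) ≤ 4)
    calc Real.exp (m * -β) ≤ Real.exp (-4) := Real.exp_le_exp.mpr (by linarith)
      _ ≤ 1 / 5 := by norm_num at h5 ⊢; exact h5
  rw [div_le_iff₀ hβ]
  calc (4 / 5 : ℝ) ≤ 1 - q ^ m := by linarith
    _ = gsum β m * (1 - q) := hkey.symm
    _ ≤ gsum β m * β := mul_le_mul_of_nonneg_left hq1 (gsum_nonneg β m)

/-! ## §2  The witness family on the tower in d = 2 -/

section Witness

variable {k a : ℕ}

/-- Integer index vectors of the d = 2 boxes. [folklore] -/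
def iv (x₀ x₁ : ℤ) : Fin 2 → ℤ := ![x₀, x₁]

/-- (x₀, x₁) with 0 ≤ x₀, x₁ ≤ a is a box index. [folklore] -/
private theorem iv_mem_Icc {x₀ x₁ : ℤ} (h0 : 0 ≤ x₀) (h0' : x₀ ≤ a) (h1 : 0 ≤ x₁) (h1' : x₁ ≤ a) :
    iv x₀ x₁ ∈ Set.Icc (0 : Fin 2 → ℤ) (fun _ => (a : ℤ)) := by
  refine ⟨fun μ => ?_, fun μ => ?_⟩ <;> fin_cases μ <;> simpa [iv]

/-- Level 0 (the fine box Λ₀) of the tower. [cite: Balaban1984PropagatorsII, (2.3)–(2.4) p.224] -/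
def lv0 (k : ℕ) : Fin (k + 1) := ⟨0, Nat.succ_pos k⟩

/-- Level 1 (the coarse box Λ₁) of the tower, k ≥ 1. [cite: Balaban1984PropagatorsII, (2.3)–(2.4) p.224] -/
def lv1 (hk : 1 ≤ k) : Fin (k + 1) := ⟨1, by omega⟩

/-- The point of level z with index (x₀, x₁) (clamped into the box). [cite: Balaban1984PropagatorsII, (2.45) p.231] -/
def pt (z : Fin (k + 1)) (a : ℕ) (x₀ x₁ : ℤ) : TW 2 k a := (z, clampBox a (iv x₀ x₁))

/-- **The base point y₀** = (level 1, (0, 0)): the near corner of the coarse box, on the wall to the fine box.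
[cite: Balaban1984PropagatorsII, (2.61) p.234 (the sup over y ∈ 𝔅)] -/
def base (hk : 1 ≤ k) (a : ℕ) : TW 2 k a := pt (lv1 hk) a 0 0

/-- In one level: d((z,(p,q)), (z,(p′,q′))) ≤ |p − p′| + |q − q′| for box indices (a staircase; the in-box case of (2.66)).
[cite: Balaban1984PropagatorsII, (2.46) p.231] -/
theorem dist_pt_le (L : ℕ) (z : Fin (k + 1)) {p q p' q' : ℤ} (hp : 0 ≤ p ∧ p ≤ a) (hq : 0 ≤ q ∧ q ≤ a)
    (hp' : 0 ≤ p' ∧ p' ≤ a) (hq' : 0 ≤ q' ∧ q' ≤ a) :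
    (graph L).dist (pt z a p q) (pt z a p' q') ≤ (p - p').natAbs + (q - q').natAbs := by
  have h := dist_le_latL1Dist_of_lvl (d := 2) (k := k) L z (clampBox a (iv p q)) (clampBox a (iv p' q'))
  rw [zv_clampBox (iv_mem_Icc hp.1 hp.2 hq.1 hq.2), zv_clampBox (iv_mem_Icc hp'.1 hp'.2 hq'.1 hq'.2)] at h
  simpa [pt, latL1Dist, Fin.sum_univ_two, iv] using h

/-- **The wall bond** (0,(a,Lx′)) ∼ (1,(0,x′)) for Lx′ ≤ a, L ≥ 1: the coarse near-face point sits on the sublattice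
LΛ₀ of the fine far face. [cite: Balaban1984PropagatorsII, (2.46) p.231] -/
theorem adj_fineFar_coarse (hk : 1 ≤ k) {L : ℕ} (hL : 1 ≤ L) {x' : ℕ} (hLx : L * x' ≤ a) :
    (graph L).Adj (pt (lv0 k) a (a : ℤ) ((L : ℤ) * x')) (pt (lv1 hk) a 0 x') := by
  have hx : x' ≤ a := le_trans (by simpa using Nat.mul_le_mul_right x' hL) hLx
  have hm1 : iv (a : ℤ) ((L : ℤ) * x') ∈ Set.Icc (0 : Fin 2 → ℤ) (fun _ => (a : ℤ)) :=
    iv_mem_Icc (by positivity) le_rfl (by positivity) (by exact_mod_cast hLx)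
  have hm2 : iv (0 : ℤ) (x' : ℤ) ∈ Set.Icc (0 : Fin 2 → ℤ) (fun _ => (a : ℤ)) :=
    iv_mem_Icc le_rfl (by positivity) (by positivity) (by exact_mod_cast hx)
  rw [graph, SimpleGraph.fromRel_adj]
  refine ⟨fun heq => ?_, Or.inl (Or.inr ⟨?_, ?_, ?_, fun μ hμ => ?_⟩)⟩
  · have := congrArg (fun p : TW 2 k a => (p.1 : ℕ)) heq
    simp [pt, lv0, lv1] at this
  · simp [lvl, pt, lv0, lv1]
  · simp [pt, clampBox, iv]
  · simp [pt, clampBox, iv]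
  · fin_cases μ
    · exact absurd rfl hμ
    · show zv (clampBox a (iv (a : ℤ) ((L : ℤ) * x'))) 1 = (L : ℤ) * zv (clampBox a (iv 0 (x' : ℤ))) 1
      rw [zv_clampBox hm1, zv_clampBox hm2]
      rfl

/-- **The path bound (2.48) for the witness family, PROVED on the tower**: d(y₀, (0,(a−t, Lx′+z))) ≤ x′ + 1 + (t + z)
(x′ coarse bonds along the near face, one wall bond, t + z fine bonds). [cite: Balaban1984PropagatorsII, (2.46)–(2.48)
pp.231–232] -/
theorem dist_base_finePt_le (hk : 1 ≤ k) {L : ℕ} (hL : 1 ≤ L) {x' t z : ℕ} (ht : t ≤ a) (hz : L * x' + z ≤ a) :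
    (graph L).dist (base hk a) (pt (lv0 k) a ((a : ℤ) - t) ((L : ℤ) * x' + z)) ≤ x' + 1 + (t + z) := by
  have hc := graph_connected (d := 2) (k := k) (a := a) L
  have hLx : L * x' ≤ a := le_trans (Nat.le_add_right _ _) hz
  have hx : (x' : ℤ) ≤ a := by exact_mod_cast le_trans (by simpa using Nat.mul_le_mul_right x' hL) hLx
  have hLx' : (L : ℤ) * x' ≤ a := by exact_mod_cast hLx
  have hz' : (L : ℤ) * x' + z ≤ a := by exact_mod_cast hz
  have ht' : (t : ℤ) ≤ a := by exact_mod_cast ht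
  have h1 : (graph L).dist (base hk a) (pt (lv1 hk) a 0 x') ≤ x' := by
    simpa [base] using dist_pt_le L (lv1 hk) (p := 0) (q := 0) (p' := 0) (q' := x') ⟨le_rfl, by positivity⟩
      ⟨le_rfl, by positivity⟩ ⟨le_rfl, by positivity⟩ ⟨by positivity, hx⟩
  have h2 : (graph L).dist (pt (lv1 hk) a 0 x') (pt (lv0 k) a (a : ℤ) ((L : ℤ) * x')) = 1 :=
    SimpleGraph.dist_eq_one_iff_adj.mpr (adj_fineFar_coarse hk hL hLx).symm
  have h3 : (graph L).dist (pt (lv0 k) a (a : ℤ) ((L : ℤ) * x')) (pt (lv0 k) a ((a : ℤ) - t) ((L : ℤ) * x' + z))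
      ≤ t + z := by
    simpa using dist_pt_le L (lv0 k) (p := a) (q := (L : ℤ) * x') (p' := (a : ℤ) - t) (q' := (L : ℤ) * x' + z)
      ⟨by positivity, le_rfl⟩ ⟨by positivity, hLx'⟩ ⟨by linarith, by linarith⟩ ⟨by positivity, hz'⟩
  calc (graph L).dist (base hk a) (pt (lv0 k) a ((a : ℤ) - t) ((L : ℤ) * x' + z))
      ≤ (graph L).dist (base hk a) (pt (lv1 hk) a 0 x') +
          ((graph L).dist (pt (lv1 hk) a 0 x') (pt (lv0 k) a (a : ℤ) ((L : ℤ) * x')) +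
            (graph L).dist (pt (lv0 k) a (a : ℤ) ((L : ℤ) * x')) (pt (lv0 k) a ((a : ℤ) - t) ((L : ℤ) * x' + z))) :=
        hc.dist_triangle.trans (Nat.add_le_add_left hc.dist_triangle _)
    _ ≤ x' + (1 + (t + z)) := by rw [h2]; gcongr
    _ = x' + 1 + (t + z) := by ring

/-- The witness index set: x′ < n (crossing point), t ≤ a (depth into the fine box), z < L (fine window). [folklore] -/
def witIdx (n a L : ℕ) : Finset (ℕ × ℕ × ℕ) := range n ×ˢ (range (a + 1) ×ˢ range L)

/-- The witness site map (x′, t, z) ↦ (0, (a − t, Lx′ + z)). [folklore] -/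
def witSite (k a L : ℕ) (i : ℕ × ℕ × ℕ) : TW 2 k a := pt (lv0 k) a ((a : ℤ) - i.2.1) ((L : ℤ) * i.1 + i.2.2)

/-- The witness path bound x′ + 1 + (t + z). [folklore] -/
def witBound (i : ℕ × ℕ × ℕ) : ℝ := ((i.1 + 1 + (i.2.1 + i.2.2) : ℕ) : ℝ)

/-- Index bounds inside the witness set. [folklore] -/
private theorem witIdx_bounds {n a L : ℕ} (hna : n * L ≤ a + 1) {i : ℕ × ℕ × ℕ} (hi : i ∈ witIdx n a L) :
    i.2.1 ≤ a ∧ L * i.1 + i.2.2 ≤ a ∧ i.2.2 < L := by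
  simp only [witIdx, mem_product, mem_range] at hi
  obtain ⟨h1, h2, h3⟩ := hi
  refine ⟨by omega, ?_, h3⟩
  have : L * i.1 + L ≤ n * L := by
    have := Nat.mul_le_mul_right L (Nat.succ_le_of_lt h1)
    rwa [Nat.succ_mul, mul_comm] at this
  omega

/-- **The witness sites are pairwise distinct** (nL ≤ a + 1): Lx′ + z with z < L determines (x′, z). [folklore] -/
private theorem witSite_injOn {n a L : ℕ} (hna : n * L ≤ a + 1) : Set.InjOn (witSite k a L) ↑(witIdx n a L) := by
  intro i hi j hj hij
  obtain ⟨hi1, hi2, hi3⟩ := witIdx_bounds hna (Finset.mem_coe.mp hi)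
  obtain ⟨hj1, hj2, hj3⟩ := witIdx_bounds hna (Finset.mem_coe.mp hj)
  have hm : ∀ {t w : ℕ}, t ≤ a → w ≤ a → iv ((a : ℤ) - t) (w : ℤ) ∈ Set.Icc (0 : Fin 2 → ℤ) (fun _ => (a : ℤ)) :=
    fun ht hw => iv_mem_Icc (by linarith [(Nat.cast_le (α := ℤ)).mpr ht]) (by linarith) (by positivity)
      (by exact_mod_cast hw)
  have h := congrArg (fun p : TW 2 k a => zv p.2) hij
  simp only [witSite, pt] at h
  rw [show ((L : ℤ) * i.1 + i.2.2) = ((L * i.1 + i.2.2 : ℕ) : ℤ) by push_cast; ring,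
    show ((L : ℤ) * j.1 + j.2.2) = ((L * j.1 + j.2.2 : ℕ) : ℤ) by push_cast; ring,
    zv_clampBox (hm hi1 hi2), zv_clampBox (hm hj1 hj2)] at h
  have h0 : ((a : ℤ) - i.2.1) = (a : ℤ) - j.2.1 := congr_fun h 0
  have h1 : ((L * i.1 + i.2.2 : ℕ) : ℤ) = ((L * j.1 + j.2.2 : ℕ) : ℤ) := congr_fun h 1
  have hw : L * i.1 + i.2.2 = L * j.1 + j.2.2 := by exact_mod_cast h1
  have hx : i.1 = j.1 := by
    have := congrArg (· / L) hw
    simpa only [Nat.mul_add_div (by omega : 0 < L), Nat.div_eq_of_lt hi3, Nat.div_eq_of_lt hj3, add_zero] using this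
  refine Prod.ext hx (Prod.ext (by omega) ?_)
  rw [hx] at hw
  omega

/-- The witness sum factorises: e^{−β}·G_n·G_{a+1}·G_L = Σ_{(x′,t,z)} e^{−β(x′+1+t+z)}. [folklore] -/
private theorem witness_sum_eq (β : ℝ) (n a L : ℕ) :
    Real.exp (-β) * gsum β n * gsum β (a + 1) * gsum β L = ∑ i ∈ witIdx n a L, Real.exp (-(β * witBound i)) := by
  unfold gsum witIdx
  rw [mul_assoc, mul_assoc, Finset.sum_mul_sum, ← Finset.sum_product', Finset.sum_mul_sum, ← Finset.sum_product',
    Finset.mul_sum]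
  refine Finset.sum_congr rfl fun i _ => ?_
  rw [← Real.exp_add, ← Real.exp_add, ← Real.exp_add, witBound]
  push_cast
  ring_nf

/-- **The factorised lower bound for the (2.61) row sum at y₀**: e^{−β}G_nG_{a+1}G_L ≤ Σ_{y′∈𝔅} e^{−βd(y₀,y′)}
(β ≥ 0, L ≥ 1, k ≥ 1, nL ≤ a + 1) — `B6Lemma21Counterexample.sum_exp_ge_of_paths` with the PROVED path bounds.
[cite: Balaban1984PropagatorsII, (2.61) p.234 + (2.46)–(2.48) pp.231–232] -/
theorem witness_le_sum (hk : 1 ≤ k) {L : ℕ} (hL : 1 ≤ L) {n : ℕ} (hna : n * L ≤ a + 1) {β : ℝ} (hβ : 0 ≤ β) :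
    Real.exp (-β) * gsum β n * gsum β (a + 1) * gsum β L ≤
      ∑ y' : TW 2 k a, Real.exp (-(β * tdist L (base hk a) y')) := by
  rw [witness_sum_eq]
  refine B6Lemma21Counterexample.sum_exp_ge_of_paths (tdist L) (base hk a) β hβ (witIdx n a L) (witSite k a L)
    (witSite_injOn hna) witBound fun i hi => ?_
  obtain ⟨h1, h2, -⟩ := witIdx_bounds hna hi
  unfold tdist witBound witSite
  exact_mod_cast dist_base_finePt_le hk hL h1 h2

end Witness

/-! ## §3  The printed constant is exceeded in d = 2 -/

section Main

variable {k a : ℕ}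

/-- The decisive elementary inequality: 12((4+β)/β)² < (1−β)((4/5)/β)³ for 0 < β ≤ 1/400. [folklore] -/
private theorem key_ineq {β : ℝ} (h0 : 0 < β) (h1 : β ≤ 1 / 400) :
    12 * ((4 + β) / β) ^ 2 < (1 - β) * (4 / 5 / β) ^ 3 := by
  rw [show 12 * ((4 + β) / β) ^ 2 = (12 * (4 + β) ^ 2 * β) / β ^ 3 by field_simp,
    show (1 - β) * (4 / 5 / β) ^ 3 = ((1 - β) * (64 / 125)) / β ^ 3 by field_simp; ring,
    div_lt_div_iff_of_pos_right (by positivity)]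
  nlinarith [mul_pos h0 h0, sq_nonneg β]

/-- **THE PRINTED c₁(α) IS EXCEEDED IN d = 2.**  On the tower `B6LevelTower.twGeo 2 k a M L η R` (k ≥ 1; d = `tdist L`),
at y₀ = (level 1, (0,0)):  `B6.c1 2 δ₀ α` = 12c₀(½α)² < Σ_{y′∈𝔅} e^{−αδ₀d(y₀,y′)}  whenever 0 < αδ₀ ≤ 1/400, αδ₀·n ≥ 4,
αδ₀·L ≥ 4 and nL ≤ a + 1 — hypotheses compatible with ALL hypotheses of the repaired tower lemma
`B6TowerDecomp.tower_sum_exp_le` (L ≥ 1, a ≥ 1, RM ≤ a + 1, (2.59)): see `printed_c1_exceeded_d2`, `cond259_instance`.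
[cite: Balaban1984PropagatorsII, Lemma 2.1 (2.61) p.234] -/
theorem c1_lt_sum_d2 (hk : 1 ≤ k) {L n : ℕ} {δ₀ α : ℝ} (hβ0 : 0 < α * δ₀) (hβ1 : α * δ₀ ≤ 1 / 400)
    (hn : 4 ≤ α * δ₀ * n) (hL : 4 ≤ α * δ₀ * L) (hna : n * L ≤ a + 1) :
    B6.c1 2 δ₀ α < ∑ y' : TW 2 k a, Real.exp (-(α * δ₀ * tdist L (base hk a) y')) := by
  set β := α * δ₀ with hβ
  have hL1 : 1 ≤ L := Nat.one_le_iff_ne_zero.mpr (by rintro rfl; norm_num at hL)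
  have ha4 : 4 ≤ β * (a + 1 : ℕ) := by
    have h1 : (n : ℝ) * 1 ≤ n * L := mul_le_mul_of_nonneg_left (by exact_mod_cast hL1) (Nat.cast_nonneg n)
    have h2 : (n : ℝ) * L ≤ (a + 1 : ℕ) := by exact_mod_cast hna
    nlinarith
  have he : (0 : ℝ) ≤ Real.exp (-β) := (Real.exp_pos _).le
  have h45 : (0 : ℝ) ≤ 4 / 5 / β := by positivity
  have h1 : (1 - β) * (4 / 5 / β) ≤ Real.exp (-β) * gsum β n :=
    mul_le_mul (by linarith [Real.add_one_le_exp (-β)]) (gsum_ge hβ0 hn) h45 he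
  have h2 : (1 - β) * (4 / 5 / β) * (4 / 5 / β) ≤ Real.exp (-β) * gsum β n * gsum β (a + 1) :=
    mul_le_mul h1 (gsum_ge hβ0 ha4) h45 (mul_nonneg he (gsum_nonneg β n))
  have h3 : (1 - β) * (4 / 5 / β) * (4 / 5 / β) * (4 / 5 / β) ≤
      Real.exp (-β) * gsum β n * gsum β (a + 1) * gsum β L :=
    mul_le_mul h2 (gsum_ge hβ0 hL) h45 (mul_nonneg (mul_nonneg he (gsum_nonneg β n)) (gsum_nonneg β (a + 1)))
  calc B6.c1 2 δ₀ α ≤ 12 * ((4 + β) / β) ^ 2 := c1_two_le hβ0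
    _ < (1 - β) * (4 / 5 / β) ^ 3 := key_ineq hβ0 hβ1
    _ = (1 - β) * (4 / 5 / β) * (4 / 5 / β) * (4 / 5 / β) := by ring
    _ ≤ Real.exp (-β) * gsum β n * gsum β (a + 1) * gsum β L := h3
    _ ≤ _ := witness_le_sum hk hL1 hna hβ0.le

/-- **(2.61) AS PRINTED FAILS on the tower in d = 2** in the regime of `c1_lt_sum_d2`:
¬ `B6RandomWalk.Ineq261 2 (twGeo 2 k a M L η R) δ₀ α`. [cite: Balaban1984PropagatorsII, Lemma 2.1 (2.61) p.234] -/
theorem not_ineq261_d2 (hk : 1 ≤ k) (M : ℕ) (η R : ℝ) {L n : ℕ} {δ₀ α : ℝ} (hβ0 : 0 < α * δ₀)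
    (hβ1 : α * δ₀ ≤ 1 / 400) (hn : 4 ≤ α * δ₀ * n) (hL : 4 ≤ α * δ₀ * L) (hna : n * L ≤ a + 1) :
    ¬ B6RandomWalk.Ineq261 2 (twGeo 2 k a M L η R) δ₀ α :=
  fun h => absurd (h (base hk a)) (not_le.mpr (c1_lt_sum_d2 hk hβ0 hβ1 hn hL hna))

/-- **(2.59) HOLDS at the instance**: αδ₀ = 1/400, RM = 1600² give ¼αδ₀RM = 1600 > 4 log c₀(½α) + 1 (c₀(½α) ≤ 1601 < e⁸,
e > 2.718281828). [cite: Balaban1984PropagatorsII, (2.59) p.233] -/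
theorem cond259_instance {δ₀ α : ℝ} (h : α * δ₀ = 1 / 400) : B6.Cond259 2 δ₀ α ((2560000 : ℕ) : ℝ) ((1 : ℕ) : ℝ) := by
  have hβ0 : 0 < α * δ₀ := by rw [h]; norm_num
  have hc0 : B6.c0 δ₀ (α / 2) ≤ 1601 := by have := c0_half_le hβ0; rw [h] at this; norm_num at this; exact this
  have hc0pos : 0 < B6.c0 δ₀ (α / 2) := by
    rw [B6Lemma21Counterexample.c0_closed (by linarith : 0 < α / 2 * δ₀)]
    have : Real.exp (-(α / 2 * δ₀)) < 1 := by rw [Real.exp_lt_one_iff]; linarith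
    exact div_pos (by positivity) (by linarith)
  have he8 : (1601 : ℝ) < Real.exp 8 := by
    rw [show (8 : ℝ) = (8 : ℕ) * 1 by norm_num, Real.exp_nat_mul]
    exact lt_trans (by norm_num) (pow_lt_pow_left₀ Real.exp_one_gt_d9 (by norm_num) (by norm_num))
  have hlog : Real.log (B6.c0 δ₀ (α / 2)) < 8 := (Real.log_lt_iff_lt_exp hc0pos).mpr (lt_of_le_of_lt hc0 he8)
  unfold B6.Cond259
  rw [show (1 / 4 : ℝ) * α * δ₀ = (1 / 4) * (α * δ₀) by ring, h]
  push_cast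
  linarith

/-- **KERNEL WITNESS**: on the two-level tower with L = 1600, a + 1 = 1600² (any M, η, R), at αδ₀ = 1/400 the (2.61) row
sum at y₀ = (1,(0,0)) exceeds the printed c₁(α) = 12c₀(½α)². [cite: Balaban1984PropagatorsII, Lemma 2.1 (2.61) p.234] -/
theorem printed_c1_exceeded_d2 (M : ℕ) (η R : ℝ) {δ₀ α : ℝ} (h : α * δ₀ = 1 / 400) :
    B6.c1 2 δ₀ α <
      ∑ y' : TW 2 1 2559999, Real.exp (-(α * δ₀ * (twGeo 2 1 2559999 M 1600 η R).dist (base le_rfl 2559999) y')) :=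
  c1_lt_sum_d2 (k := 1) (a := 2559999) le_rfl (L := 1600) (n := 1600) (by rw [h]; norm_num) (by rw [h])
    (by rw [h]; norm_num) (by rw [h]; norm_num) (by norm_num)

/-- **The printed-constant analogue of `B6TowerDecomp.tower_sum_exp_le` is FALSE in d = 2**: it is not the case that
every tower with L ≥ 1, a ≥ 1, RM ≤ a + 1 satisfies Σ_{y′} e^{−αδ₀d(y,y′)} ≤ 12c₀(½α)² for all 0 < α < 1, δ₀ > 0 under
(2.59) — witness k = 1, a + 1 = 1600², L = 1600, M = 1, η = 1, R = 1600², δ₀ = 1/200, α = ½ (where the repaired bound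
Σ ≤ c₁″ = 13c₀(½α)⁸ of `B6TowerDecomp.tower_sum_exp_le` does hold). [cite: Balaban1984PropagatorsII, Lemma 2.1 (2.61) p.234] -/
theorem not_tower_sum_le_printed_d2 :
    ¬ ∀ (k a L M : ℕ) (η R δ₀ α : ℝ), 1 ≤ L → 1 ≤ a → R * (M : ℝ) ≤ (a : ℝ) + 1 → 0 < α → α < 1 → 0 < δ₀ →
        B6.Cond259 2 δ₀ α R M →
        ∀ y : TW 2 k a, ∑ y' : TW 2 k a, Real.exp (-(α * δ₀ * tdist L y y')) ≤ B6.c1 2 δ₀ α := by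
  intro h
  have h1 := h 1 2559999 1600 1 1 ((2560000 : ℕ) : ℝ) (1 / 200) (1 / 2) (by norm_num) (by norm_num) (by norm_num)
    (by norm_num) (by norm_num) (by norm_num) (cond259_instance (by norm_num)) (base le_rfl 2559999)
  exact absurd h1 (not_le.mpr (printed_c1_exceeded_d2 1 1 ((2560000 : ℕ) : ℝ) (by norm_num)))

/-- (2.59) is monotone in R (M ≥ 0, αδ₀ ≥ 0). [cite: Balaban1984PropagatorsII, (2.59) p.233] -/
theorem cond259_mono_R {d : ℕ} {δ₀ α R R' M : ℝ} (h : B6.Cond259 d δ₀ α R M) (hRR : R ≤ R') (hM : 0 ≤ M)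
    (hαδ : 0 ≤ α * δ₀) : B6.Cond259 d δ₀ α R' M := by
  unfold B6.Cond259 at h ⊢
  have h2 := mul_le_mul_of_nonneg_right (mul_le_mul_of_nonneg_left hRR (by positivity : (0 : ℝ) ≤ 1 / 4 * (α * δ₀))) hM
  linarith [show (1 / 4) * α * δ₀ * R * M = (1 / 4) * (α * δ₀) * R * M by ring,
    show (1 / 4) * α * δ₀ * R' * M = (1 / 4) * (α * δ₀) * R' * M by ring]

/-- **`B6.Lemma21Printed 2 δ₀` IS REFUTED ON AN HONEST TOWER, for every δ₀ > 0 and every η**: there are L ≥ 1, a ≥ 1, R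
with RM ≤ a + 1 (M = 1) — so (2.60) holds (`B6LevelTower.twGeo_ineq260`) and the two-scale Lemma 2.1 holds
(`B6TowerDecomp.lemma21TwoScale_towers`) — such that the printed Lemma 2.1 (d = 2) fails on the one-member family
{twGeo 2 1 a 1 L η R}: at α = min{½, 1/(400δ₀)} condition (2.59) holds and (2.61) with c₁ = 12c₀(½α)² fails.
[cite: Balaban1984PropagatorsII, Lemma 2.1 (2.60)–(2.61) p.234] -/
theorem not_lemma21Printed_d2 {δ₀ : ℝ} (hδ : 0 < δ₀) (η : ℝ) :
    ∃ (a L : ℕ) (R : ℝ), 1 ≤ L ∧ 1 ≤ a ∧ R * ((1 : ℕ) : ℝ) ≤ (a : ℝ) + 1 ∧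
      B6Lemma21TwoScale.Lemma21TwoScale 2 δ₀ (fun _ : Unit => twGeo 2 1 a 1 L η R) ∧
      ¬ B6.Lemma21Printed 2 δ₀ (fun _ : Unit => twGeo 2 1 a 1 L η R) := by
  set α : ℝ := min (1 / 2) (1 / (400 * δ₀)) with hα
  have hα0 : 0 < α := lt_min (by norm_num) (by positivity)
  have hα1 : α < 1 := lt_of_le_of_lt (min_le_left _ _) (by norm_num)
  have hβ0 : 0 < α * δ₀ := mul_pos hα0 hδ
  have hβ1 : α * δ₀ ≤ 1 / 400 := by
    calc α * δ₀ ≤ 1 / (400 * δ₀) * δ₀ := mul_le_mul_of_nonneg_right (min_le_right _ _) hδ.le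
      _ = 1 / 400 := by field_simp
  set L : ℕ := ⌈4 / (α * δ₀)⌉₊ with hLdef
  have hL4 : 4 ≤ α * δ₀ * L := by
    calc (4 : ℝ) = α * δ₀ * (4 / (α * δ₀)) := by field_simp
      _ ≤ α * δ₀ * L := mul_le_mul_of_nonneg_left (Nat.le_ceil _) hβ0.le
  have hL1 : 1 ≤ L := Nat.one_le_iff_ne_zero.mpr fun h0 => by rw [h0] at hL4; norm_num at hL4
  obtain ⟨a₁, ha₁, h259⟩ := B6TowerDecomp.cond259_witness 2 hδ hα0
  set a : ℕ := max a₁ (L * L) with hadef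
  have ha1 : 1 ≤ a := le_trans ha₁ (le_max_left _ _)
  have hLL : L * L ≤ a + 1 := le_trans (le_max_right _ _) (Nat.le_succ _)
  have ha₁a : (a₁ : ℝ) ≤ (a : ℝ) := by exact_mod_cast le_max_left a₁ (L * L)
  have h259a : B6.Cond259 2 δ₀ α ((a : ℝ) + 1) ((1 : ℕ) : ℝ) :=
    cond259_mono_R h259 (by linarith) (by positivity) hβ0.le
  refine ⟨a, L, (a : ℝ) + 1, hL1, ha1, by push_cast; linarith, ?_, fun h => ?_⟩
  · exact B6TowerDecomp.lemma21TwoScale_towers 2 (fun _ => 1) (fun _ => a) (fun _ => 1) (fun _ => L) (fun _ => η)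
      (fun _ => (a : ℝ) + 1) (fun _ => hL1) (fun _ => ha1) (fun _ => by push_cast; linarith) δ₀ hδ
  · exact absurd ((h () trivial α hα0 hα1 h259a).2 (base le_rfl a))
      (not_le.mpr (c1_lt_sum_d2 (k := 1) (a := a) le_rfl hβ0 hβ1 hL4 hL4 hLL))

end Main

end Literature.MathematicalPhysics.QuantumFieldTheory.Balaban1983to89.B6Lemma21TwoDim
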